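import Summits.Ventures.CertifiedManyBodySolver.Observables.StructureFactorsLROCeiling
import Literature.MathematicalPhysics.QuantumLattice.HubbardStaggeredMomentCeiling

/-!
# M3 observables (iii), the a-priori BRAGG BUDGET: `Σ_j S_s(c•j; ψ) ≤ ((K+2)/4) · (𝒩 − 2𝒟)`

HONEST FRAMING: first certified bounds; not a superconductivity verdict; every number
certified or labelled float.  This file is KINEMATICS: an operator inequality valid for EVERY vector
`ψ` on every `L × L` torus — no bound on any Hubbard ground state is claimed here.

Companion of `Observables/StructureFactors{,SumRules,LROCeiling}.lean` (speedrun `mbsolver`, M3 team,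
seat sr-mbsolver-m3-7, D7 (iii): `STRIPE-ROWS.md` §5q "a-priori Bragg budget").  The point: the spin
structure factor summed over a SUBLATTICE of momenta `c • 𝕋_L` (`c ∈ ℤ/Lℤ`; for `L = λ μ`, `c = μ`
these are the momenta `q ∈ (2π/λ)ℤ²`, i.e. the Bragg positions of every period-`λ` order) is bounded
by the LOCAL MOMENT alone:

* `sum_blochPhase_smul_mul_star` (character orthogonality over the momentum sublattice):
  `Σ_j e^{i(c j)·x} e^{-i(c j)·y} = L² · [c•x = c•y]`;
* `sum_spinStructureOp_smul`: **`Σ_j 𝓢_s(c•j) = L² Σ_{x,y : c•x = c•y} 𝐒_x·𝐒_y`** — the momentum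
  sublattice sum is `L²` times the sum of the squared total spins of the site classes `{x : c•x = v}`;
* `posSemidef_braggBudget_sub`: if every class has at most `K` sites then
  **`L² ((K+2)/4) Σ_x m_x − Σ_j 𝓢_s(c•j) ⪰ 0`** (`m_x = n_{x↑} + n_{x↓} − 2n_{x↑}n_{x↓}` the local
  moment), from the Literature Casimir bound `Σ_{x,y∈Y} 𝐒_x·𝐒_y ≤ ((|Y|+2)/4) Σ_{x∈Y} m_x`
  (`FermionSpinMoment.posSemidef_momentCasimir_sub`: the total spin of the electrons in `Y` is at most
  half the number of singly occupied sites of `Y`);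
* `sum_spinStructureFactor_smul_le` (+ `_of_isNParticle`): for every vector `ψ`,
  **`Σ_j S_s(c•j; ψ) ≤ ((K+2)/4) · Re ⟨ψ, Σ_x m_x ψ⟩ = ((K+2)/4) (N − 2𝒟)`** on a unit `N`-particle
  vector, `𝒟 = Re ⟨ψ, Σ_x n_{x↑}n_{x↓} ψ⟩` the total double occupancy (the quantity the cell's `docc`
  rows certify);
* `card_smulFibre_smul`, `card_mul_sum_image_spinStructureFactor`: the fibres of `x ↦ c•x` are cosets
  of its kernel, so `j ↦ c•j` hits each sublattice momentum exactly `K₀ = |{x : c•x = 0}|` times, and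
  `sum_image_spinStructureFactor_le_of_isNParticle` — the HYPOTHESIS-FREE headline, each momentum of
  `c • 𝕋_L` counted once: **`Σ_{q ∈ c•𝕋_L} S_s(q; ψ) ≤ (1/4 + 1/(2K₀)) (N − 2𝒟)`**, and
  `sum_spinStructureFactor_le_of_subset_image` — the same bound for every subset `T ⊆ c • 𝕋_L` of momenta
  (a stripe star plus `(π,π)`, say), by `spinStructureFactor_nonneg`.

Reading (M3.md §2(iii)): for `L = λμ`, `c = μ` the sublattice `c • 𝕋_L` is the set of momenta
`q ∈ (2π/λ)ℤ²` and `K₀ = μ² = L²/λ²`, so per site `Σ_{q ∈ (2π/λ)ℤ²} S_s(q; ψ)/L² ≤ (1/4 + λ²/(2L²)) (n − 2d)`,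
`n = N/L²`, `d = 𝒟/L²`; at `λ = L` (`c = 1`, `K₀ = 1`) this is the full-zone sum rule `(3/4)(n − 2d)`
of `StructureFactorsSumRules` (there with equality).  TL words (lead ruling r92: no TL instance is typed): for a translation-invariant state
the Bragg weights `m_q² = lim S_s(q)/L²` therefore satisfy `Σ_{q ∈ (2π/λ)ℤ²} m_q² ≤ (n − 2d)/4` — ONE
THIRD of the sum rule (`S²` versus `S(S+1)`: long-range order is carried by the classical part of the
moment) — so a `|star| = 4` stripe wavevector has `m̄_s²(Q) ≤ (n − 2d)/16` (= `0.0547` at `n = 7/8`,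
`d = 0`) and `m_s²(π,π) ≤ (n − 2d)/4` A PRIORI, for every Hamiltonian.
Refs: Tasaki, *Physics and Mathematics of Quantum Many-Body Systems* (2020) App. A.3; Lieb, PRL 62
(1989) 1201; Hirsch, PRB 31 (1985) 4403 eq. (4.7).
-/

noncomputable section

namespace Summit.Ventures.CertifiedManyBodySolver.Observables

open Matrix Literature.MathematicalPhysics.QuantumLattice Literature.Probability.LatticeModels
open Literature.MathematicalPhysics.QuantumLattice.HubbardWave0
open Literature.MathematicalPhysics.QuantumLattice.FermionTorus
open Literature.MathematicalPhysics.QuantumLattice.FermionSpinMoment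
open scoped BigOperators ComplexConjugate ComplexOrder

section BraggBudget

variable (L : ℕ) [NeZero L]

/-! ### Character orthogonality over a momentum sublattice -/

omit [NeZero L] in
/-- `(c•k)·x = k·(c•x)` for a scalar `c ∈ ℤ/Lℤ`. -/
theorem torusDot_smul_left (c : ZMod L) (k x : TorusSite 2 L) :
    torusDot L (c • k) x = torusDot L k (c • x) := by
  simp only [torusDot, Pi.smul_apply, smul_eq_mul]
  exact Finset.sum_congr rfl fun i _ => by ring

/-- `e^{i(c k)·x} = e^{i k·(c x)}`. -/
theorem blochPhase_smul_left (c : ZMod L) (k x : TorusSite 2 L) :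
    blochPhase L (c • k) x = blochPhase L k (c • x) := by
  rw [blochPhase, blochPhase, torusDot_smul_left]

/-- **Character orthogonality over the momentum sublattice `c • 𝕋_L`**:
`Σ_j e^{i(c j)·x} e^{-i(c j)·y} = L² · [c•x = c•y]`. -/
theorem sum_blochPhase_smul_mul_star (c : ZMod L) (x y : TorusSite 2 L) :
    ∑ j : TorusSite 2 L, blochPhase L (c • j) x * star (blochPhase L (c • j) y) =
      if c • x = c • y then ((L : ℂ) ^ 2) else 0 := by
  simp_rw [blochPhase_smul_left, ← blochPhase_sub, sum_blochPhase_momentum]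
  simp only [sub_eq_zero]

/-! ### The momentum-sublattice sum of the spin structure operator -/

/-- **`Σ_j 𝓢_s(c•j) = Σ_{x,y : c•x = c•y} L² 𝐒_x·𝐒_y`.** -/
theorem sum_spinStructureOp_smul (c : ZMod L) :
    ∑ j : TorusSite 2 L, spinStructureOp L (c • j) =
      ∑ x : TorusSite 2 L, ∑ y : TorusSite 2 L,
        (if c • x = c • y then ((L : ℂ) ^ 2) • fermionSpinDot (ofTorusSite x) (ofTorusSite y) else 0) := by
  simp only [spinStructureOp]
  rw [Finset.sum_comm]
  refine Finset.sum_congr rfl fun x _ => ?_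
  rw [Finset.sum_comm]
  refine Finset.sum_congr rfl fun y _ => ?_
  rw [← Finset.sum_smul, sum_blochPhase_smul_mul_star]
  split_ifs <;> simp

/-- The site class (fibre) `{x : c•x = v}` of the sublattice map. -/
def smulFibre (c : ZMod L) (v : TorusSite 2 L) : Finset (TorusSite 2 L) :=
  Finset.univ.filter fun x => c • x = v

/-- Membership in the site class: `x ∈ smulFibre c v ↔ c•x = v`. -/
theorem mem_smulFibre {c : ZMod L} {v x : TorusSite 2 L} : x ∈ smulFibre L c v ↔ c • x = v := by
  simp [smulFibre]

/-- **Fibre decomposition**: `Σ_{x,y : c•x = c•y} A x y = Σ_v Σ_{x,y ∈ fibre v} A x y`. -/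
theorem sum_sum_ite_smul_eq_sum_fibre (c : ZMod L)
    (A : TorusSite 2 L → TorusSite 2 L → Matrix (Finset (Orb (FermionTorus 2 L))) (Finset (Orb (FermionTorus 2 L))) ℂ) :
    ∑ x : TorusSite 2 L, ∑ y : TorusSite 2 L, (if c • x = c • y then A x y else 0) =
      ∑ v : TorusSite 2 L, ∑ x ∈ smulFibre L c v, ∑ y ∈ smulFibre L c v, A x y := by
  have hfib : ∀ v : TorusSite 2 L, ∀ x ∈ smulFibre L c v,
      ∑ y ∈ smulFibre L c v, A x y = ∑ y : TorusSite 2 L, (if c • x = c • y then A x y else 0) := by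
    intro v x hx
    rw [mem_smulFibre] at hx
    rw [smulFibre, Finset.sum_filter]
    refine Finset.sum_congr rfl fun y _ => ?_
    rw [← hx]
    exact if_congr eq_comm rfl rfl
  rw [Finset.sum_congr rfl fun v _ => Finset.sum_congr rfl (hfib v)]
  exact (Finset.sum_fiberwise_of_maps_to (s := Finset.univ) (t := Finset.univ) (g := fun x => c • x)
    (fun _ _ => Finset.mem_univ _) _).symm

/-! ### The operator inequality -/

/-- Casimir bound on one site class: `((K+2)/4) Σ_{x ∈ F} m_x − Σ_{x,y ∈ F} 𝐒_x·𝐒_y ⪰ 0` if `|F| ≤ K`. -/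
theorem posSemidef_fibreCasimir_sub (F : Finset (TorusSite 2 L)) {K : ℕ} (hK : F.card ≤ K) :
    (((((K : ℂ) + 2) / 4) • ∑ x ∈ F, (localMoment (ofTorusSite x) :
        Matrix (Finset (Orb (FermionTorus 2 L))) (Finset (Orb (FermionTorus 2 L))) ℂ)) -
      ∑ x ∈ F, ∑ y ∈ F, fermionSpinDot (ofTorusSite x) (ofTorusSite y)).PosSemidef := by
  have hinj : Function.Injective (ofTorusSite (d := 2) (L := L)) :=
    (FermionTorus.equivTorusSite (d := 2) (L := L)).symm.injective
  have hinjF : Set.InjOn (ofTorusSite (d := 2) (L := L)) F := hinj.injOn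
  have h := posSemidef_momentCasimir_sub (F.image (ofTorusSite (d := 2) (L := L)))
  rw [Finset.card_image_of_injOn hinjF, Finset.sum_image hinjF, Finset.sum_image hinjF] at h
  simp_rw [Finset.sum_image hinjF] at h
  have hcast : (0 : ℂ) ≤ ((K : ℂ) - F.card) / 4 := by
    rw [show ((K : ℂ) - F.card) / 4 = ((((K : ℝ) - F.card) / 4 : ℝ) : ℂ) by push_cast; ring]
    have : (F.card : ℝ) ≤ K := by exact_mod_cast hK
    exact Complex.zero_le_real.2 (by linarith)
  have h2 := h.add ((posSemidef_finset_sum F fun x _ => posSemidef_localMoment (ofTorusSite x)).smul hcast)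
  convert h2 using 1
  module

/-- **The a-priori Bragg budget (operator form)**: if every site class `{x : c•x = v}` has at most `K`
sites, `L² ((K+2)/4) Σ_x m_x − Σ_j 𝓢_s(c•j) ⪰ 0`. -/
theorem posSemidef_braggBudget_sub (c : ZMod L) {K : ℕ} (hK : ∀ v : TorusSite 2 L, (smulFibre L c v).card ≤ K) :
    ((((L : ℂ) ^ 2) * (((K : ℂ) + 2) / 4)) • ∑ x : TorusSite 2 L, (localMoment (ofTorusSite x) :
        Matrix (Finset (Orb (FermionTorus 2 L))) (Finset (Orb (FermionTorus 2 L))) ℂ) -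
      ∑ j : TorusSite 2 L, spinStructureOp L (c • j)).PosSemidef := by
  have hL2 : (0 : ℂ) ≤ (L : ℂ) ^ 2 := by
    rw [show ((L : ℂ) ^ 2) = (((L : ℝ) ^ 2 : ℝ) : ℂ) by push_cast; rfl]
    exact Complex.zero_le_real.2 (by positivity)
  have h := (posSemidef_finset_sum (Finset.univ : Finset (TorusSite 2 L)) fun v _ =>
    posSemidef_fibreCasimir_sub L (smulFibre L c v) (hK v)).smul hL2
  have hm : ∑ v : TorusSite 2 L, ∑ x ∈ smulFibre L c v, (localMoment (ofTorusSite x) :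
        Matrix (Finset (Orb (FermionTorus 2 L))) (Finset (Orb (FermionTorus 2 L))) ℂ) =
      ∑ x : TorusSite 2 L, localMoment (ofTorusSite x) :=
    Finset.sum_fiberwise_of_maps_to (s := Finset.univ) (t := Finset.univ) (g := fun x => c • x)
      (fun _ _ => Finset.mem_univ _) _
  rw [sum_spinStructureOp_smul, sum_sum_ite_smul_eq_sum_fibre]
  convert h using 1
  rw [Finset.sum_sub_distrib, smul_sub, ← Finset.smul_sum, smul_smul, hm]
  congr 1
  simp only [Finset.smul_sum]

/-! ### Expectation form -/

omit [NeZero L] in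
/-- `expect` is additive: `⟨ψ, (A - B) ψ⟩ = ⟨ψ, A ψ⟩ - ⟨ψ, B ψ⟩`. -/
private theorem expect_sub'' (A B : Matrix (Finset (Orb (FermionTorus 2 L))) (Finset (Orb (FermionTorus 2 L))) ℂ)
    (ψ : Fock (Orb (FermionTorus 2 L))) : expect (A - B) ψ = expect A ψ - expect B ψ := by
  simp [expect, sub_mulVec, dotProduct_sub]

omit [NeZero L] in
/-- PSD ⇒ nonnegative real expectation. -/
private theorem re_expect_nonneg_of_posSemidef''
    {P : Matrix (Finset (Orb (FermionTorus 2 L))) (Finset (Orb (FermionTorus 2 L))) ℂ}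
    (hP : P.PosSemidef) (ψ : Fock (Orb (FermionTorus 2 L))) : 0 ≤ (expect P ψ).re := by
  obtain ⟨hre, -⟩ := Complex.nonneg_iff.mp (hP.dotProduct_mulVec_nonneg ψ)
  simpa [expect] using hre

/-- **The a-priori Bragg budget**: for EVERY vector `ψ`, if every site class `{x : c•x = v}` has at most
`K` sites, `Σ_j S_s(c•j; ψ) ≤ ((K+2)/4) · Re ⟨ψ, Σ_x m_x ψ⟩`. -/
theorem sum_spinStructureFactor_smul_le (c : ZMod L) {K : ℕ}
    (hK : ∀ v : TorusSite 2 L, (smulFibre L c v).card ≤ K) (ψ : Fock (Orb (FermionTorus 2 L))) :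
    ∑ j : TorusSite 2 L, spinStructureFactor L (c • j) ψ ≤
      (((K : ℝ) + 2) / 4) * (expect (∑ x : TorusSite 2 L, (localMoment (ofTorusSite x) :
        Matrix (Finset (Orb (FermionTorus 2 L))) (Finset (Orb (FermionTorus 2 L))) ℂ)) ψ).re := by
  have hL : (0 : ℝ) < (L : ℝ) ^ 2 := by
    have : (0 : ℝ) < (L : ℝ) := by exact_mod_cast Nat.pos_of_ne_zero (NeZero.ne L)
    positivity
  have h := re_expect_nonneg_of_posSemidef'' L (posSemidef_braggBudget_sub L c hK) ψ
  rw [expect_sub'' L, expect_smul, Complex.sub_re,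
    show ((L : ℂ) ^ 2) * (((K : ℂ) + 2) / 4) = (((L : ℝ) ^ 2 * (((K : ℝ) + 2) / 4) : ℝ) : ℂ) by push_cast; ring,
    Complex.re_ofReal_mul] at h
  unfold spinStructureFactor
  rw [← Finset.sum_div, ← Complex.re_sum, ← expect_sum, div_le_iff₀ hL]
  linarith [h]

/-- **The a-priori Bragg budget on a unit `N`-particle vector**:
`Σ_j S_s(c•j; ψ) ≤ ((K+2)/4) · (N − 2𝒟)`, `𝒟 = Re ⟨ψ, Σ_x n_{x↑}n_{x↓} ψ⟩`. -/
theorem sum_spinStructureFactor_smul_le_of_isNParticle (c : ZMod L) {K : ℕ}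
    (hK : ∀ v : TorusSite 2 L, (smulFibre L c v).card ≤ K) {N : ℕ}
    {ψ : Fock (Orb (FermionTorus 2 L))} (hψ : IsNParticle N ψ) (hnorm : star ψ ⬝ᵥ ψ = 1) :
    ∑ j : TorusSite 2 L, spinStructureFactor L (c • j) ψ ≤
      (((K : ℝ) + 2) / 4) * ((N : ℝ) - 2 * (expect (∑ x : TorusSite 2 L,
        (numberOp (ofTorusSite x) 0 * numberOp (ofTorusSite x) 1 :
          Matrix (Finset (Orb (FermionTorus 2 L))) (Finset (Orb (FermionTorus 2 L))) ℂ)) ψ).re) := by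
  have hm : (expect (∑ x : TorusSite 2 L, (localMoment (ofTorusSite x) :
        Matrix (Finset (Orb (FermionTorus 2 L))) (Finset (Orb (FermionTorus 2 L))) ℂ)) ψ).re =
      (N : ℝ) - 2 * (expect (∑ x : TorusSite 2 L, (numberOp (ofTorusSite x) 0 * numberOp (ofTorusSite x) 1 :
          Matrix (Finset (Orb (FermionTorus 2 L))) (Finset (Orb (FermionTorus 2 L))) ℂ)) ψ).re := by
    rw [sum_localMoment_eq L, expect_add, expect_smul, Complex.add_re,
      re_expect_sum_siteDensity_of_isNParticle L hψ, hnorm, show (-2 : ℂ) = ((-2 : ℝ) : ℂ) by norm_num,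
      Complex.re_ofReal_mul]
    simp only [Complex.one_re, mul_one]
    ring
  have h := sum_spinStructureFactor_smul_le L c hK ψ
  rwa [hm] at h

/-! ### Each sublattice momentum counted once -/

/-- The fibres of `x ↦ c•x` are cosets of its kernel: `|{x : c•x = c•j}| = |{x : c•x = 0}|`. -/
theorem card_smulFibre_smul (c : ZMod L) (j : TorusSite 2 L) :
    (smulFibre L c (c • j)).card = (smulFibre L c 0).card := by
  refine Finset.card_bij' (fun x _ => x - j) (fun y _ => y + j) (fun x hx => ?_) (fun y hy => ?_)
    (fun x _ => sub_add_cancel x j) (fun y _ => add_sub_cancel_right y j)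
  · rw [mem_smulFibre] at hx ⊢
    rw [smul_sub, hx, sub_self]
  · rw [mem_smulFibre] at hy ⊢
    rw [smul_add, hy, zero_add]

/-- Every fibre of `x ↦ c•x` has at most `|{x : c•x = 0}|` elements (exactly that many, or none). -/
theorem card_smulFibre_le (c : ZMod L) (v : TorusSite 2 L) :
    (smulFibre L c v).card ≤ (smulFibre L c 0).card := by
  by_cases hv : ∃ j : TorusSite 2 L, c • j = v
  · obtain ⟨j, rfl⟩ := hv
    exact (card_smulFibre_smul L c j).le
  · have h0 : smulFibre L c v = ∅ :=
      Finset.filter_eq_empty_iff.mpr fun x _ hx => hv ⟨x, hx⟩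
    rw [h0, Finset.card_empty]
    exact Nat.zero_le _

/-- `|{x : c•x = 0}| · Σ_{q ∈ c•𝕋_L} S_s(q; ψ) = Σ_j S_s(c•j; ψ)`: the map `j ↦ c•j` hits each momentum of
the sublattice `c • 𝕋_L` exactly `|{x : c•x = 0}|` times. -/
theorem card_mul_sum_image_spinStructureFactor (c : ZMod L) (ψ : Fock (Orb (FermionTorus 2 L))) :
    ((smulFibre L c 0).card : ℝ) *
        ∑ q ∈ Finset.univ.image (fun j : TorusSite 2 L => c • j), spinStructureFactor L q ψ =
      ∑ j : TorusSite 2 L, spinStructureFactor L (c • j) ψ := by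
  rw [Finset.mul_sum]
  symm
  rw [← Finset.sum_fiberwise_of_maps_to (s := Finset.univ)
    (t := Finset.univ.image (fun j : TorusSite 2 L => c • j)) (g := fun j => c • j)
    (fun j hj => Finset.mem_image_of_mem _ hj)]
  refine Finset.sum_congr rfl fun q hq => ?_
  obtain ⟨j₀, -, rfl⟩ := Finset.mem_image.mp hq
  have hconst : ∀ j ∈ Finset.univ.filter (fun j : TorusSite 2 L => c • j = c • j₀),
      spinStructureFactor L (c • j) ψ = spinStructureFactor L (c • j₀) ψ := by
    intro j hj
    rw [(Finset.mem_filter.mp hj).2]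
  rw [Finset.sum_congr rfl hconst, Finset.sum_const, nsmul_eq_mul]
  congr 1
  exact_mod_cast card_smulFibre_smul L c j₀

/-- **The a-priori Bragg budget per sublattice momentum** (each momentum of `c • 𝕋_L` counted ONCE),
hypothesis-free: on a unit `N`-particle vector,
`Σ_{q ∈ c•𝕋_L} S_s(q; ψ) ≤ (1/4 + 1/(2K)) · (N − 2𝒟)`, `K = |{x : c•x = 0}|`
(for `L = λμ`, `c = μ`: the momenta `q ∈ (2π/λ)ℤ²`, `K = μ² = L²/λ²`; per site this is
`Σ_{q ∈ (2π/λ)ℤ²} S_s(q; ψ)/L² ≤ (1/4 + λ²/(2L²)) (n − 2d)`). -/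
theorem sum_image_spinStructureFactor_le_of_isNParticle (c : ZMod L) {N : ℕ}
    {ψ : Fock (Orb (FermionTorus 2 L))} (hψ : IsNParticle N ψ) (hnorm : star ψ ⬝ᵥ ψ = 1) :
    ∑ q ∈ Finset.univ.image (fun j : TorusSite 2 L => c • j), spinStructureFactor L q ψ ≤
      ((1 / 4 : ℝ) + 1 / (2 * (smulFibre L c 0).card)) * ((N : ℝ) - 2 * (expect (∑ x : TorusSite 2 L,
        (numberOp (ofTorusSite x) 0 * numberOp (ofTorusSite x) 1 :
          Matrix (Finset (Orb (FermionTorus 2 L))) (Finset (Orb (FermionTorus 2 L))) ℂ)) ψ).re) := by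
  set M := ((N : ℝ) - 2 * (expect (∑ x : TorusSite 2 L,
        (numberOp (ofTorusSite x) 0 * numberOp (ofTorusSite x) 1 :
          Matrix (Finset (Orb (FermionTorus 2 L))) (Finset (Orb (FermionTorus 2 L))) ℂ)) ψ).re) with hM
  set K := (smulFibre L c 0).card with hKdef
  have hKpos : (0 : ℝ) < K := by
    have : 0 < K := Finset.card_pos.mpr ⟨0, (mem_smulFibre L).mpr (smul_zero c)⟩
    exact_mod_cast this
  have h := sum_spinStructureFactor_smul_le_of_isNParticle L c (card_smulFibre_le L c) hψ hnorm
  rw [← card_mul_sum_image_spinStructureFactor L c ψ] at h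
  have key : ((1 / 4 : ℝ) + 1 / (2 * K)) * M = (((K : ℝ) + 2) / 4 * M) / K := by
    field_simp
    ring
  rw [key, le_div_iff₀ hKpos]
  linarith [h]

/-- **Any set `T` of sublattice momenta** (e.g. a stripe star together with `(π,π)` inside `(π/8)ℤ²`,
`16 ∣ L`, `c = L/16`): since every `S_s(q; ψ) ≥ 0` (`spinStructureFactor_nonneg`),
`Σ_{q ∈ T} S_s(q; ψ) ≤ (1/4 + 1/(2K₀)) · (N − 2𝒟)` whenever `T ⊆ c • 𝕋_L`. -/
theorem sum_spinStructureFactor_le_of_subset_image (c : ZMod L) {T : Finset (TorusSite 2 L)}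
    (hT : T ⊆ Finset.univ.image (fun j : TorusSite 2 L => c • j)) {N : ℕ}
    {ψ : Fock (Orb (FermionTorus 2 L))} (hψ : IsNParticle N ψ) (hnorm : star ψ ⬝ᵥ ψ = 1) :
    ∑ q ∈ T, spinStructureFactor L q ψ ≤
      ((1 / 4 : ℝ) + 1 / (2 * (smulFibre L c 0).card)) * ((N : ℝ) - 2 * (expect (∑ x : TorusSite 2 L,
        (numberOp (ofTorusSite x) 0 * numberOp (ofTorusSite x) 1 :
          Matrix (Finset (Orb (FermionTorus 2 L))) (Finset (Orb (FermionTorus 2 L))) ℂ)) ψ).re) :=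
  (Finset.sum_le_sum_of_subset_of_nonneg hT fun q _ _ => spinStructureFactor_nonneg L q ψ).trans
    (sum_image_spinStructureFactor_le_of_isNParticle L c hψ hnorm)

end BraggBudget

end Summit.Ventures.CertifiedManyBodySolver.Observables
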